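import Literature.Barriers.ValiantsHypothesis.CT23LowerBoundsFromSuccinctHittingSets
import Literature.Barriers.ValiantsHypothesis.CT23Lemma47Holds
import HarnessLib

/-!
# Equations for the evaluation vectors of `VP_n(n^b)` by constant-free projection circuits of size
# `n^{O(b)}` — the BarrierLever reading of Chatterjee–Tengse Lemma 4.7 (val-lit t24 g10)

Theorem-only companion of `CT23LowerBoundsFromSuccinctHittingSets.lean`; NO named facts, no
definitions. It turns the CONSUMER SENTENCE of the docstring of the named fact `CT23_lemma_4_7`
(Chatterjee–Tengse, *Lower Bounds from Succinct Hitting Sets*, arXiv:2309.07612, v2 Lemma 4.7 /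
v1 Lemma 50) into a theorem CONDITIONAL ON THAT FACT BY NAME (`(h : CT23_lemma_4_7)`): for every
FIXED size exponent `b`, for all large `n`, there is a nonzero multilinear integer polynomial `P`
in the `binom(2n, n)` variables indexing the interpolating set `I_{n,n}`, computed by a
constant-free fan-in-two circuit with projection gates of size `≤ n^c` (with `≤ n^c` bound
workspace variables), which vanishes at the evaluation vector of every member of the tree's class
`SmallCircuits F n b = {f : deg f ≤ n, complexity f ≤ n^b}` (the class `VP_n(n^b)` of the
barrier hypothesis `SuccinctHittingSetsForVP`, `AlgebraicNaturalProofs.lean`). The REGIME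
HYPOTHESIS `(nds)^c ≤ binom(n+d, d)` of the fact is discharged here: with `d = n` and
`s = n^{b+1}` it reads `n^{(b+3)c} ≤ binom(2n, n)`, true for `n ≥ 4^{(b+3)c}` since
`n^k ≤ 2^n ≤ binom(2n, n)` (`pow_le_two_pow_of_four_pow_le`, `two_pow_le_choose_two_mul_self`).

Honest framing (val-lit): this is the "`VPSPACE⁰`-natural equations for `VP_n(n^b)`" evidence the
source offers on how definable equations for `VP` can be — by its Remark 1.5 INCOMPARABLE to the
`VNP_N`-natural equations that crux `stmt-ValiantsHypothesis-8749` `SingleSizeEquations` of route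
BarrierLever asks for; it conditions nothing in the kernel beyond what `CT23_lemma_4_7` does and
is UNCONDITIONAL since `CT23_lemma_4_7_holds` (val-lit t18 g8, `CT23Lemma47Holds.lean`) is in
the tree: `smallCircuits_evalEquations`. `VP ≠ VNP` is NOT proved and nothing here bears on it.

## Main statements

* **`CT23_lemma_4_7.smallCircuits`**: the corollary described above, conditional on the fact by
  name; **`smallCircuits_evalEquations`**: the same, UNCONDITIONAL (fed with
  `CT23_lemma_4_7_holds`) (private arithmetic helpers
  `pow_le_two_pow_of_four_pow_le`: `4^k ≤ n → n^k ≤ 2^n`; `two_pow_le_choose_two_mul_self`: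
  `2^n ≤ binom(2n, n)`; `smallCircuits_regime`: the regime inequality at `d = n`, `s = n^{b+1}`).

## References

* [ChatterjeeTengse2023] P. Chatterjee, A. Tengse, *Lower Bounds from Succinct Hitting Sets*,
  arXiv:2309.07612, Lemma 4.7 and Remark 1.5 (v1: Lemma 50; held text `paper:arxiv-2309.07612`
  p0017.txt:L58–L70, Remark p0005.txt).
* [ForbesShpilkaVolk2018] M. A. Forbes, A. Shpilka, B. L. Volk, *Succinct hitting sets and
  barriers to proving lower bounds for algebraic circuits*, Theory of Computing 14 (2018), Def. 1 /
  Question 6 (the classes `SmallCircuits`, `SuccinctHittingSetsForVP` of the tree).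
-/

open MvPolynomial

namespace Literature.Barriers.ValiantsHypothesis

open Literature.Computability.AlgebraicComplexity

/-! ### Elementary growth bounds: `n^k ≤ 2^n ≤ binom(2n, n)` -/

/-- `n^k ≤ 2^n` as soon as `4^k ≤ n`. [folklore] -/
private theorem pow_le_two_pow_of_four_pow_le {k n : ℕ} (h : 4 ^ k ≤ n) : n ^ k ≤ 2 ^ n := by
  -- `n < 2^(m+1)` with `2^m ≤ n`, so `n^k < 2^{k(m+1)}` and `k(m+1) ≤ 2^m ≤ n` once `2k ≤ m`… we use
  -- the cleaner route through `Nat.log 2`.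
  rcases Nat.eq_zero_or_pos k with rfl | hk
  · simp [Nat.one_le_two_pow]
  have hn : 0 < n := lt_of_lt_of_le (by positivity) h
  set m := Nat.log 2 n with hm
  have h2m : 2 ^ m ≤ n := Nat.pow_log_le_self 2 hn.ne'
  have hnlt : n < 2 ^ (m + 1) := Nat.lt_pow_succ_log_self (by norm_num) n
  -- `4^k = 2^(2k) ≤ n < 2^(m+1)` gives `2k ≤ m`
  have h2k : 2 * k ≤ m := by
    have : 2 ^ (2 * k) < 2 ^ (m + 1) := by
      calc 2 ^ (2 * k) = 4 ^ k := by rw [pow_mul]; norm_num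
        _ ≤ n := h
        _ < 2 ^ (m + 1) := hnlt
    have := (Nat.pow_lt_pow_iff_right (by norm_num : 1 < 2)).1 this
    omega
  -- `k * (m + 1) ≤ 2^m`: from `m + 1 ≤ 2^(m - k)`-type bounds; we use `k(m+1) ≤ m(m+1)/2 ≤ 2^m`.
  have hkm : k * (m + 1) ≤ 2 ^ m := by
    have h1 : k * (m + 1) ≤ m * (m + 1) / 2 := by
      have : 2 * (k * (m + 1)) ≤ m * (m + 1) := by nlinarith
      omega
    have h2 : m * (m + 1) / 2 ≤ 2 ^ m := by
      have key : ∀ j : ℕ, j * (j + 1) ≤ 2 * 2 ^ j := by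
        intro j
        induction j with
        | zero => simp
        | succ j ih =>
          have h2 : 2 ^ (j + 1) = 2 * 2 ^ j := by ring
          have hj : j < 2 ^ j := Nat.lt_two_pow_self
          nlinarith [hj, ih]
      have := key m
      omega
    exact h1.trans h2
  calc n ^ k ≤ (2 ^ (m + 1)) ^ k := Nat.pow_le_pow_left hnlt.le k
    _ = 2 ^ (k * (m + 1)) := by rw [← pow_mul, mul_comm]
    _ ≤ 2 ^ (2 ^ m) := Nat.pow_le_pow_right (by norm_num) hkm
    _ ≤ 2 ^ n := Nat.pow_le_pow_right (by norm_num) h2m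

/-- `2^n ≤ binom(2n, n)` (Pascal's rule and `binom(2n+1, n) = binom(2n+1, n+1)`). [folklore] -/
private theorem two_pow_le_choose_two_mul_self (n : ℕ) : 2 ^ n ≤ (2 * n).choose n := by
  induction n with
  | zero => simp
  | succ n ih =>
    have h1 : (2 * (n + 1)).choose (n + 1) =
        (2 * n + 1).choose n + (2 * n + 1).choose (n + 1) := by
      rw [show 2 * (n + 1) = (2 * n + 1) + 1 by ring, Nat.choose_succ_succ]
    have h2 : (2 * n + 1).choose (n + 1) = (2 * n + 1).choose n := Nat.choose_symm_half n
    have h3 : (2 * n).choose n ≤ (2 * n + 1).choose n := Nat.choose_le_succ _ _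
    rw [h1, h2, pow_succ]; omega

/-- **The regime inequality of Lemma 4.7 at `d = n`, `s = n^{b+1}`:**
`(n · n · n^{b+1})^c ≤ binom(n + n, n)` for `n ≥ 4^{(b+3)c}`. [folklore] -/
private theorem smallCircuits_regime {b c n : ℕ} (h4 : 4 ^ ((b + 3) * c) ≤ n) :
    (n * n * n ^ (b + 1)) ^ c ≤ (n + n).choose n := by
  have hpow : (n * n * n ^ (b + 1)) ^ c = n ^ ((b + 3) * c) := by
    rw [show n * n * n ^ (b + 1) = n ^ (b + 3) by ring, ← pow_mul]
  rw [hpow, ← two_mul]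
  exact (pow_le_two_pow_of_four_pow_le h4).trans (two_pow_le_choose_two_mul_self n)

/-! ### The corollary in BarrierLever currency -/

/-- **Equations for `VP_n(n^b)` by constant-free projection circuits of size `n^{O(b)}`** (the
consumer reading of CT23 Lemma 4.7, conditional on the named fact): for every field `F` of
characteristic `0` and every size exponent `b` there are `c, n₀` such that for every `n ≥ n₀`
there is a nonzero MULTILINEAR integer polynomial `P` in the variables `x^{≤ n}` (indexing the
interpolating set `I_{n,n}`), computed — as `rename Sum.inl P`, with `t ≤ n^c` bound workspace
variables — by a fan-in-two constant-free circuit with projection gates of size `≤ n^c`, and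
vanishing at the evaluation vector `evalVector F n f` of every `f ∈ SmallCircuits F n b`
(`deg f ≤ n`, `complexity f ≤ n^b`). Obtained from the fact at `d = n`, `s = n^{b+1}`
(`SmallCircuits F n b ⊆ SmallCircuits F n (b+1)`), its regime hypothesis discharged by
`smallCircuits_regime`; `c = (b+3)·c₄.₇`, `n₀ = max(N₀, 4^c)`.
[cite: ChatterjeeTengse2023, Lemma 4.7 with Remark 1.5 (v1: Lemma 50; p0017.txt:L58–L60)] -/
theorem CT23_lemma_4_7.smallCircuits (h : CT23_lemma_4_7) (F : Type) [Field F] [CharZero F]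
    (b : ℕ) :
    ∃ c n₀ : ℕ, ∀ n : ℕ, n₀ ≤ n →
      ∃ (t : ℕ) (P : MvPolynomial (monomialsDegLE n n) ℤ)
        (Q : ProjCircuit ℤ (monomialsDegLE n n ⊕ Fin t)),
        P ≠ 0 ∧ (∀ v, P.degreeOf v ≤ 1) ∧ Q.IsFanInTwo ∧ Q.HasSignConstants ∧
          Q.Computes (rename Sum.inl P) ∧ t ≤ n ^ c ∧ Q.size ≤ n ^ c ∧
            ∀ f ∈ SmallCircuits F n b,
              eval (evalVector F n f) (MvPolynomial.map (Int.castRingHom F) P) = 0 := by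
  obtain ⟨c, N₀, hc⟩ := h F
  refine ⟨(b + 3) * c, max N₀ (4 ^ ((b + 3) * c)), fun n hn => ?_⟩
  have hN : N₀ ≤ n := le_trans (le_max_left _ _) hn
  have h4 : 4 ^ ((b + 3) * c) ≤ n := le_trans (le_max_right _ _) hn
  have h1 : 1 ≤ n := le_trans (Nat.one_le_pow _ _ (by norm_num)) h4
  have hs : N₀ ≤ n ^ (b + 1) :=
    hN.trans (by simpa using Nat.pow_le_pow_right h1 (Nat.succ_le_succ (Nat.zero_le b)))
  obtain ⟨t, P, Q, hP0, hPml, hQ2, hQsc, hQc, ht, hQs, hvan⟩ :=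
    hc n n (n ^ (b + 1)) hN hN hs (smallCircuits_regime h4)
  have hpow : (n * n * n ^ (b + 1)) ^ c = n ^ ((b + 3) * c) := by
    rw [show n * n * n ^ (b + 1) = n ^ (b + 3) by ring, ← pow_mul]
  refine ⟨t, P, Q, hP0, hPml, hQ2, hQsc, hQc, hpow ▸ ht, hpow ▸ hQs, fun f hf => ?_⟩
  have hf' : f ∈ SmallCircuits F n (b + 1) := smallCircuits_mono F (Nat.le_succ b) h1 hf
  exact hvan f hf'.1 hf'.2

/-- **Equations for `VP_n(n^b)` by constant-free projection circuits of size `n^{O(b)}`,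
UNCONDITIONALLY** (CT23 Lemma 4.7 is a theorem of the tree, `CT23_lemma_4_7_holds`): for every
field `F` of characteristic `0` and every `b`, for all large `n`, a nonzero multilinear integer
polynomial in the variables `x^{≤ n}`, computed with `≤ n^c` bound workspace variables by a
fan-in-two constant-free circuit with projection gates of size `≤ n^c`, vanishes at the evaluation
vector of every `f ∈ SmallCircuits F n b`. HONEST READING: these are equations for the
EVALUATION VECTORS of `SmallCircuits F n b`, computed by CONSTANT-FREE PROJECTION circuits
(projection gates = `VPSPACE⁰` power, Poizat/Malod) of size `n^{O(b)}` — NOT `VP`- or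
`VNP(N)`-size equations (the source's Remark 1.5: incomparable); in route BarrierLever this
CONDITIONS `stmt-ValiantsHypothesis-8749` `SingleSizeEquations` / `-8745` `DefinableEquations`
(the "VPSPACE-explicit (CT23) equations … for one fixed `b`" their docstring mentions, here for
every `b`) and touches neither `SuccinctHittingSetsForVP ℂ` (`-14610`) nor the natural-proofs
barrier. [cite: ChatterjeeTengse2023, Lemma 4.7 with Remark 1.5 (v1: Lemma 50; p0017.txt:L58–L60)] -/
theorem smallCircuits_evalEquations (F : Type) [Field F] [CharZero F] (b : ℕ) :
    ∃ c n₀ : ℕ, ∀ n : ℕ, n₀ ≤ n →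
      ∃ (t : ℕ) (P : MvPolynomial (monomialsDegLE n n) ℤ)
        (Q : ProjCircuit ℤ (monomialsDegLE n n ⊕ Fin t)),
        P ≠ 0 ∧ (∀ v, P.degreeOf v ≤ 1) ∧ Q.IsFanInTwo ∧ Q.HasSignConstants ∧
          Q.Computes (rename Sum.inl P) ∧ t ≤ n ^ c ∧ Q.size ≤ n ^ c ∧
            ∀ f ∈ SmallCircuits F n b,
              eval (evalVector F n f) (MvPolynomial.map (Int.castRingHom F) P) = 0 :=
  CT23_lemma_4_7.smallCircuits CT23_lemma_4_7_holds F b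

end Literature.Barriers.ValiantsHypothesis
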